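import Summits.BirchSwinnertonDyer.BirchSwinnertonDyer.Theorems.SylvesterTwoHeegnerIndexCoupledTelescopeClassSystemFlipHalved
import Summits.BirchSwinnertonDyer.BirchSwinnertonDyer.Theorems.SylvesterTwoHeegnerIndexCoupledTelescopeClassSystemChoices
import Summits.BirchSwinnertonDyer.BirchSwinnertonDyer.Theorems.SylvesterTwoHeegnerIndexCoupledTelescopeProvenanceHalved
import Summits.BirchSwinnertonDyer.BirchSwinnertonDyer.Theorems.SylvesterTwoHeegnerIndexCoupledTelescopeReflectionClassesHalved
import Summits.BirchSwinnertonDyer.BirchSwinnertonDyer.Theorems.SylvesterTwoHeegnerIndexCoupledTelescopeHalvedChoices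
import Summits.BirchSwinnertonDyer.BirchSwinnertonDyer.Theorems.SylvesterTwoHeegnerIndexCoupledTelescopeKummerClassAdmissible
import Summits.BirchSwinnertonDyer.BirchSwinnertonDyer.Theorems.SylvesterTwoHeegnerIndexCoupledTelescopeBottomClassOrder
import Summits.BirchSwinnertonDyer.BirchSwinnertonDyer.Theorems.SylvesterTwoHeegnerIndexCoupledTelescopeKummerFiveSylvester
import Summits.BirchSwinnertonDyer.BirchSwinnertonDyer.Theorems.SylvesterTwoHeegnerIndexCoupledTelescopeResidueLeaves
import Summits.BirchSwinnertonDyer.BirchSwinnertonDyer.Theorems.SylvesterTwoHeegnerIndexCMFlipCoherentFrame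
import Summits.BirchSwinnertonDyer.BirchSwinnertonDyer.Theorems.SylvesterTwoHeegnerIndexCMDataCoupledFrame
import Summits.BirchSwinnertonDyer.BirchSwinnertonDyer.Theorems.SylvesterTwoHeegnerIndexCMDataRationality
import Literature.NumberTheory.EllipticCurves.RingClassFieldCubeRoots
import Literature.NumberTheory.EllipticCurves.MordellWeilRankZeroProofs
import HarnessLib

/-!
# The COUPLED Cassels–Tate telescope, RESIDUE 7′ — THE ROWS' CONTRACT `stub_residueSevenHalved` OF VARIANT Q ON THE
# HALVED KOLYVAGIN SYSTEM, ASSEMBLED MODULO ITS DISPLAYED INPUTS (crux `UpperOffV0HSYPlus`, stmt-BirchSwinnertonDyer-19804)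

Skeleton of record VARIANT Q (`Cruxes/UpperOffV0HSYPlus/Lines/coupled_variantQ.lean` d342db51dc602551), stub
`stub_residueSevenHalved` = RESIDUE 7′ = the `hR` binder of `SylvesterTwoCoupledTelescope.tailSeven_of_residue_halved` (#44b,
p737468) VERBATIM (rows `p ≡ 7 (9)`; planner D736/D759/D789/D793/D801 (3)/D810).  ONE theorem whose TYPE is the stub's,
behind the displayed hypotheses of the lineage: HSY's modular parametrisation `Dt` of degree `6`, the NAMED height display
`hD` (#19), (ES2) `hES2`, THEOREM C `hC` (`SylvesterTwoNonneg.HSYPointTwoDivisibleSevenModNine`; in the skeleton the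
sorry-free `thmC_closed hF`) and the TOWER FIXING (W2-b) `hW2b` (= `stub_levelFixingSeven Dt hdeg`'s conclusion VERBATIM,
the registered research stub; never restated weaker).  This is the MIRROR of g31's `residueFour_of_printInputs`
(`…CoupledTelescopeResidueFour`, 826f59526b1672e9) on the halved files: provenance (T-L5) H-C
`provenance_halved_sylvesterPair`; the global choices VERBATIM (`exists_coherent_emb`, `exists_levelFixers`,
`exists_sylvesterPoints`, `exists_coherentGenerators`, `exists_frameTransport_pinned`, `exists_coupledFrame`, `∛3, ∛p ∈ K[9p]`,
`exists_bottom_transversal`) + the HALVED choices H-G `exists_halvedChoices_sylvesterTower` (`s`, a half `H′`, the half fixer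
`N″`, the level involutions `φ n` — from `hW2b`); the halved class system H-E `exists_classSystemHalved_sylvesterPair` (l.74,
l.79c, l.100–120) and its FLIPs H-F `classSystemHalved_flip_sylvesterPair` (l.87–98; bottom link H-D, THEOREM C); the rows'
`Adm_X` (B-V: l.83–85, (T-L3) `cebotarev_kernelForm_sylvesterPair_lines`; H-I `zsmul_kummerMapTorsion_mem_admLines`:
`c′_B(1)`; H-J `kolyvaginClassesHalved_mem_admLines_sylvesterPair`: l.81/82); l.79 `two_pow_pred_zsmul_kummerMapTorsion_ne_zero`;
the (T-L2)′ leaves `tl2Leaf_cubeSumCurve_of_flip` (g31, one call per side); the ℚ-Kummer five (`kummerFive_of_torsion_transport`,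
`A(ℚ)` finite by HSY Thm. 1.4; `kummerFive_of_generator_transport`).
* ★ `residueSevenHalved_of_printInputs (Dt) (hdeg) (hD) (hES2) (hC) (hW2b) : <stub_residueSevenHalved's type>`.
HONEST LABEL: a CONDITIONAL closure (five displayed inputs, two of them — THEOREM C and (W2-b) — NOT in print: cell lemma W2
via the registered stub `stub_levelFixingSeven`, Theorem C = PRINT + (W2-b) in the skeleton); the stub is NOT closed on the
ledger by this file; nothing asserted on 19804; X12.CMAtTwo NOT proved; BSD not claimed for any curve.  Theorems only (no
definition / named fact / instance / notation).  Sources: [McCallumLMS1991] §4–§5, Thm. 5.4, Cor. 5.6; [GrossLMS1991] §3–§5;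
[HuShuYin2019] Thm. 1.4, Thm. C, §2 Prop. 2.4, §4.1; [Nekovar2007] Prop. 4.9; memo g44 §4–§5.
-/

set_option linter.dupNamespace false -- Summits modules are `Summit.<Summit>.<Problem>…` by design
set_option autoImplicit false

noncomputable section

open scoped Classical AddSubgroup

open WeierstrassCurve Literature.NumberTheory.EllipticCurves Field NumberField IsDedekindDomain
  Literature.NumberTheory.GaloisRepresentations Literature.NumberTheory.GaloisCohomology
  Literature.GroupTheory.FiniteAbelian Literature.NumberTheory.EllipticCurves.KolyvaginDescent
  Literature.NumberTheory.EllipticCurves.HuShuYin2019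
  Literature.NumberTheory.EllipticCurves.ModularForms
  Literature.NumberTheory.EllipticCurves.KolyvaginCocycle
  Literature.NumberTheory.EllipticCurves.RingClassField
open Summit.BirchSwinnertonDyer.BirchSwinnertonDyer.Theses.SylvesterTwoHeegnerIndex
  hiding HSYPointTwoDivisibleSevenModNine
open Summit.BirchSwinnertonDyer.BirchSwinnertonDyer.Theorems.SylvesterTwoCMFlip
  Summit.BirchSwinnertonDyer.BirchSwinnertonDyer.Theorems.SylvesterTwoCMHalf
  Summit.BirchSwinnertonDyer.BirchSwinnertonDyer.Theorems.SylvesterTwoCMData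
  Summit.BirchSwinnertonDyer.Rank1Residual.X11b Summit.BirchSwinnertonDyer.Rank1Residual.X11b.RingClassTower

namespace Summit.BirchSwinnertonDyer.BirchSwinnertonDyer.Theorems.SylvesterTwoCoupledTelescope

set_option maxHeartbeats 3200000 in
/-- ★ **RESIDUE 7′ — `stub_residueSevenHalved` of VARIANT Q MODULO ITS DISPLAYED INPUTS** (`Dt` of degree `6`, the named
display `hD`, (ES2) `hES2`, THEOREM C `hC`, the tower fixing (W2-b) `hW2b`): the stub's statement VERBATIM.  Composition of the
landed leaves on the HALVED Kolyvagin system (module docstring); the mirror of `residueFour_of_printInputs`.  CONDITIONAL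
closure; the ledger stub is NOT closed; BSD is not proved by any of this.
[cite: McCallumLMS1991, §4–§5, Thm. 5.4, Cor. 5.6] [cite: GrossLMS1991, §3 (3.3)–(3.7), §4, Prop. 5.4]
[cite: HuShuYin2019, Thm. 1.4, Thm. C, §2 Prop. 2.4, §4.1] [cite: Nekovar2007, Prop. 4.9] -/
theorem residueSevenHalved_of_printInputs
    (Dt : ModularParametrizationData (⟨0, 0, 1, 0, -1⟩ : WeierstrassCurve ℚ) 243) (hdeg : Dt.deg = 6)
    (hD : shaAnPair_mul_height_eq_two_zpow_mul_height_named)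
    (hES2 : Nekovar2007.cmPoint_frobeniusCongruence)
    (hC : SylvesterTwoNonneg.HSYPointTwoDivisibleSevenModNine)
    (hW2b : ∀ (p : ℕ), p.Prime → p % 9 = 7 → ∀ (K : Type) [Field K] [NumberField K] (ω : K), ω ^ 2 + ω + 1 = 0 →
      Module.finrank ℚ K = 2 → ∀ (ι : K →+* ℂ) (v : HeightOneSpectrum (𝓞 K)), ((3 : ℕ) : 𝓞 K) ∈ v.asIdeal → ∀ (n : ℕ), n ≠ 0 → (∀ q ∈ n.primeFactors, q % 3 = 2) →
      ∀ (e : ringClassField K ι (9 * p * n) →+* AlgebraicClosure K), (∀ k : K, e (algebraMap K (ringClassField K ι (9 * p * n)) k) = algebraMap K (AlgebraicClosure K) k) →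
      ∀ (y : ((⟨0, 0, 1, 0, -1⟩ : WeierstrassCurve ℚ).baseChange (ringClassField K ι (9 * p * n))).toAffine.Point),
        Affine.Point.map (W' := (⟨0, 0, 1, 0, -1⟩ : WeierstrassCurve ℚ)) (ringClassField K ι (9 * p * n)).subtype.toRatAlgHom y =
          Dt.φ (heegnerTau ((n : ℤ) ^ 2 * (81 * ((p : ℤ) ^ 2 + 4 * p + 16)), (n : ℤ) * (-(9 * (4 * (p : ℤ) ^ 2 + 17 * p + 72))), 4 * (p : ℤ) ^ 2 + 18 * p + 81)) →
      ∀ (τ : absoluteGaloisGroup (v.adicCompletion K)) (φ : ringClassField K ι (9 * p * n) ≃ₐ[K] ringClassField K ι (9 * p * n)),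
        (∀ x : ringClassField K ι (9 * p * n), (show AlgebraicClosure K ≃ₐ[K] AlgebraicClosure K from resGal (K := K) (v.adicCompletion K) τ) (e x) = e (φ x)) → φ * φ = 1 →
        pointGalHom (⟨0, 0, 1, 0, -1⟩ : WeierstrassCurve ℚ) (ringClassField K ι (9 * p * n)) (φ.restrictScalars ℚ) y = y) :
    PublishedFactsTwoPlus →
    ∀ (p : ℕ), p.Prime → p % 9 = 7 → (¬ ∃ x : ZMod p, x ^ 3 = 3) → ∀ (A B : WeierstrassCurve ℚ) [A.IsElliptic] [A.IsGloballyMinimal] [B.IsElliptic]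
        [B.IsGloballyMinimal], (∃ C : VariableChange ℚ, C • B = HuShuYin2019.cubeSumCurve (p : ℚ)) →
        (∃ C : VariableChange ℚ, C • A = HuShuYin2019.cubeSumCurve (3 * (p : ℚ) ^ 2)) → 4 < Nat.card (AddCommGroup.primaryComponent B.sha 2) *
            Nat.card (AddCommGroup.primaryComponent A.sha 2) → ∀ (qB qA : ℚ), shaAn B = (qB : ℂ) → shaAn A = (qA : ℂ) → qB * qA ≠ 0 →
        ∀ (K : Type) [Field K] [NumberField K] (ω : K), ω ^ 2 + ω + 1 = 0 → Module.finrank ℚ K = 2 → ∀ (CB : VariableChange ℚ) (hCB : CB • B = HuShuYin2019.cubeSumCurve (p : ℚ))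
          (P : B.toAffine.Point) (Y : (B.baseChange K).toAffine.Point), ¬ IsOfFinAddOrder (WeierstrassCurve.QuadraticDescent.incl K B P) →
          (∀ Q : B.toAffine.Point, ∃ m : ℤ, IsOfFinAddOrder (WeierstrassCurve.QuadraticDescent.incl K B Q - m • WeierstrassCurve.QuadraticDescent.incl K B P)) →
          ((qB * qA : ℚ) : ℝ) * WeierstrassCurve.Affine.Point.canonicalHeight (WeierstrassCurve.QuadraticDescent.incl K B P) = (2 : ℝ) ^ (if p % 9 = 4 then (0 : ℤ) else -2) *
              WeierstrassCurve.Affine.Point.canonicalHeight Y →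
        -- THE RESIDUE: provenance, then for every level `κ ≥ max(M₀, 1)`, every pinned one-φ datum
        -- and every Weil datum, the rows' level-`κ` leaves
        ∃ (M₀ : ℕ) (x₀ T : ((cubeSumCurve (p : ℚ)).baseChange K).toAffine.Point), IsOfFinAddOrder T ∧
        Affine.Point.congrEquiv (congrArg (fun W : WeierstrassCurve ℚ ↦ W.baseChange K) hCB)
            (VariableChange.pointEquivBaseChange B CB K Y) = (2 : ℤ) • (((2 ^ M₀ : ℕ) : ℤ) • x₀ + T) ∧ 2 * (M₀ : ℤ) ≤ padicValRat 2 (qB * qA) ∧ ∀ κ : ℕ, M₀ ≤ κ → 1 ≤ κ →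
        ∀ (φA : Isogeny ((cubeSumCurve (3 * (p : ℚ) ^ 2)).baseChange K) ((cubeSumCurve (3 * (p : ℚ) ^ 2)).baseChange K))
          (fnA : geomTorsion ((cubeSumCurve (3 * (p : ℚ) ^ 2)).baseChange K) ((2 ^ κ * 2 ^ κ : ℕ) : ℤ) →+ geomTorsion ((cubeSumCurve (3 * (p : ℚ) ^ 2)).baseChange K) ((2 ^ κ * 2 ^ κ : ℕ) : ℤ))
          (hfnA : ∀ (g : absoluteGaloisGroup K) (Q : geomTorsion ((cubeSumCurve (3 * (p : ℚ) ^ 2)).baseChange K) ((2 ^ κ * 2 ^ κ : ℕ) : ℤ)),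
            fnA (ContinuousMonoidHom.id _ g • Q) = g • fnA Q), (∀ (x y : AlgebraicClosure K)
            (h : (((cubeSumCurve (3 * (p : ℚ) ^ 2)).baseChange K).baseChange (AlgebraicClosure K)).toAffine.Nonsingular x y), ∃ h', φA (Affine.Point.some x y h) =
              Affine.Point.some (algebraMap K (AlgebraicClosure K) ω ^ 2 * x) (algebraMap K (AlgebraicClosure K) ω ^ 3 * y) h') →
          (∀ Q : geomTorsion ((cubeSumCurve (3 * (p : ℚ) ^ 2)).baseChange K) ((2 ^ κ * 2 ^ κ : ℕ) : ℤ),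
            ((fnA Q : geomTorsion ((cubeSumCurve (3 * (p : ℚ) ^ 2)).baseChange K) ((2 ^ κ * 2 ^ κ : ℕ) : ℤ)) : geomPoints ((cubeSumCurve (3 * (p : ℚ) ^ 2)).baseChange K)) = φA Q) →
        ∀ (φB : Isogeny ((cubeSumCurve (p : ℚ)).baseChange K) ((cubeSumCurve (p : ℚ)).baseChange K))
          (fnB : geomTorsion ((cubeSumCurve (p : ℚ)).baseChange K) ((2 ^ κ * 2 ^ κ : ℕ) : ℤ) →+ geomTorsion ((cubeSumCurve (p : ℚ)).baseChange K) ((2 ^ κ * 2 ^ κ : ℕ) : ℤ))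
          (hfnB : ∀ (g : absoluteGaloisGroup K) (Q : geomTorsion ((cubeSumCurve (p : ℚ)).baseChange K) ((2 ^ κ * 2 ^ κ : ℕ) : ℤ)),
            fnB (ContinuousMonoidHom.id _ g • Q) = g • fnB Q), (∀ (x y : AlgebraicClosure K)
            (h : (((cubeSumCurve (p : ℚ)).baseChange K).baseChange (AlgebraicClosure K)).toAffine.Nonsingular x y), ∃ h', φB (Affine.Point.some x y h) =
              Affine.Point.some (algebraMap K (AlgebraicClosure K) ω ^ 2 * x) (algebraMap K (AlgebraicClosure K) ω ^ 3 * y) h') →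
          (∀ Q : geomTorsion ((cubeSumCurve (p : ℚ)).baseChange K) ((2 ^ κ * 2 ^ κ : ℕ) : ℤ),
            ((fnB Q : geomTorsion ((cubeSumCurve (p : ℚ)).baseChange K) ((2 ^ κ * 2 ^ κ : ℕ) : ℤ)) : geomPoints ((cubeSumCurve (p : ℚ)).baseChange K)) = φB Q) →
        ∀ (eA : geomTorsion ((cubeSumCurve (3 * (p : ℚ) ^ 2)).baseChange K) ((2 ^ κ * 2 ^ κ : ℕ) : ℤ) → geomTorsion ((cubeSumCurve (3 * (p : ℚ) ^ 2)).baseChange K) ((2 ^ κ * 2 ^ κ : ℕ) : ℤ) → AlgebraicClosure K)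
          (hμA : ∀ S T, eA S T ^ (2 ^ κ * 2 ^ κ) = 1) (hadd₁A : ∀ S₁ S₂ T, eA (S₁ + S₂) T = eA S₁ T * eA S₂ T) (hadd₂A : ∀ S T₁ T₂, eA S (T₁ + T₂) = eA S T₁ * eA S T₂)
          (hgalA : ∀ (σ : absoluteGaloisGroup K) (S T : geomTorsion ((cubeSumCurve (3 * (p : ℚ) ^ 2)).baseChange K) ((2 ^ κ * 2 ^ κ : ℕ) : ℤ)), σ • eA S T = eA (σ • S) (σ • T)),
          (∀ T, eA T T = 1) → (∀ T, (∀ S, eA S T = 1) → T = 0) →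
        ∀ (eB : geomTorsion ((cubeSumCurve (p : ℚ)).baseChange K) ((2 ^ κ * 2 ^ κ : ℕ) : ℤ) → geomTorsion ((cubeSumCurve (p : ℚ)).baseChange K) ((2 ^ κ * 2 ^ κ : ℕ) : ℤ) → AlgebraicClosure K)
          (hμB : ∀ S T, eB S T ^ (2 ^ κ * 2 ^ κ) = 1) (hadd₁B : ∀ S₁ S₂ T, eB (S₁ + S₂) T = eB S₁ T * eB S₂ T)
          (hadd₂B : ∀ S T₁ T₂, eB S (T₁ + T₂) = eB S T₁ * eB S T₂)
          (hgalB : ∀ (σ : absoluteGaloisGroup K) (S T : geomTorsion ((cubeSumCurve (p : ℚ)).baseChange K) ((2 ^ κ * 2 ^ κ : ℕ) : ℤ)),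
            σ • eB S T = eB (σ • S) (σ • T)),
          (∀ T, eB T T = 1) → (∀ T, (∀ S, eB S T = 1) → T = 0) →
        ∃ (Kol : ℕ → Prop)
          (AdmA : Set (galH1Torsion ((cubeSumCurve (3 * (p : ℚ) ^ 2)).baseChange K) ((2 ^ κ * 2 ^ κ : ℕ) : ℤ)))
          (AdmB : Set (galH1Torsion ((cubeSumCurve (p : ℚ)).baseChange K) ((2 ^ κ * 2 ^ κ : ℕ) : ℤ)))
          (x : galH1Torsion ((cubeSumCurve (p : ℚ)).baseChange K) ((2 ^ κ * 2 ^ κ : ℕ) : ℤ))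
          (cA : ℕ → galH1Torsion ((cubeSumCurve (3 * (p : ℚ) ^ 2)).baseChange K) ((2 ^ κ * 2 ^ κ : ℕ) : ℤ))
          (cB : ℕ → galH1Torsion ((cubeSumCurve (p : ℚ)).baseChange K) ((2 ^ κ * 2 ^ κ : ℕ) : ℤ))
          (yA : galH1Torsion (cubeSumCurve (3 * (p : ℚ) ^ 2)) ((2 ^ κ * 2 ^ κ : ℕ) : ℤ))
          (yB : galH1Torsion (cubeSumCurve (p : ℚ)) ((2 ^ κ * 2 ^ κ : ℕ) : ℤ)),
          -- the Kolyvagin primes OF THIS LEVEL: rational primes inert in `K`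
          (∀ ℓ, Kol ℓ → ℓ.Prime ∧ (Ideal.span {(ℓ : 𝓞 K)}).IsPrime) ∧
          -- (T-L5) the bottom class `x = δ x₀` of exact order, `c_B 1 = 2^{M₀} x`
          x = kummerMapTorsion ((cubeSumCurve (p : ℚ)).baseChange K) ((2 ^ κ * 2 ^ κ : ℕ) : ℤ)
            (((cubeSumCurve (p : ℚ)).baseChange K).zsmul_geomPoints_surjective_of_charZero
              (Int.natCast_ne_zero.mpr (mul_ne_zero (pow_ne_zero κ two_ne_zero) (pow_ne_zero κ two_ne_zero)))) x₀ ∧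
          ((2 : ℤ) ^ (2 * κ - 1)) • x ≠ 0 ∧ cB 1 = ((2 : ℤ) ^ M₀) • x ∧
          -- admissibility (the rows' ONE set per curve; `0` and the restrictions from `ℚ` belong to it)
          (∀ n, KolSupp Kol n → Odd n.primeFactors.card → cA n ∈ AdmA) ∧
          (∀ n, KolSupp Kol n → Even n.primeFactors.card → cB n ∈ AdmB) ∧
          (0 : galH1Torsion ((cubeSumCurve (3 * (p : ℚ) ^ 2)).baseChange K) ((2 ^ κ * 2 ^ κ : ℕ) : ℤ)) ∈ AdmA ∧ (0 : galH1Torsion ((cubeSumCurve (p : ℚ)).baseChange K) ((2 ^ κ * 2 ^ κ : ℕ) : ℤ)) ∈ AdmB ∧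
          (∀ u ∈ selmerGroup (cubeSumCurve (3 * (p : ℚ) ^ 2)) ((2 ^ κ * 2 ^ κ : ℕ) : ℤ), resTorsion (cubeSumCurve (3 * (p : ℚ) ^ 2)) K ((2 ^ κ * 2 ^ κ : ℕ) : ℤ) u ∈ AdmA) ∧
          (∀ u ∈ selmerGroup (cubeSumCurve (p : ℚ)) ((2 ^ κ * 2 ^ κ : ℕ) : ℤ), resTorsion (cubeSumCurve (p : ℚ)) K ((2 ^ κ * 2 ^ κ : ℕ) : ℤ) u ∈ AdmB) ∧
          -- (T-L1) the two FLIPs with multiples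
          (∀ ℓ m, Kol ℓ → KolSupp Kol (ℓ * m) → Even m.primeFactors.card →
            ∀ v : HeightOneSpectrum (𝓞 K), (ℓ : 𝓞 K) ∈ v.asIdeal → ∀ a : ℕ,
            (((2 : ℤ) ^ a) • cA (ℓ * m) ∈ selmerLocalKer ((cubeSumCurve (3 * (p : ℚ) ^ 2)).baseChange K)
                (v.adicCompletion K) ((2 ^ κ * 2 ^ κ : ℕ) : ℤ) ↔
              ((2 : ℤ) ^ a) • cB m ∈ ((cubeSumCurve (p : ℚ)).baseChange K).torsionLocalKer
                (v.adicCompletion K) ((2 ^ κ * 2 ^ κ : ℕ) : ℤ))) ∧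
          (∀ ℓ m, Kol ℓ → KolSupp Kol (ℓ * m) → Odd m.primeFactors.card →
            ∀ v : HeightOneSpectrum (𝓞 K), (ℓ : 𝓞 K) ∈ v.asIdeal → ∀ a : ℕ,
            (((2 : ℤ) ^ a) • cB (ℓ * m) ∈ selmerLocalKer ((cubeSumCurve (p : ℚ)).baseChange K)
                (v.adicCompletion K) ((2 ^ κ * 2 ^ κ : ℕ) : ℤ) ↔
              ((2 : ℤ) ^ a) • cA m ∈ ((cubeSumCurve (3 * (p : ℚ) ^ 2)).baseChange K).torsionLocalKer
                (v.adicCompletion K) ((2 ^ κ * 2 ^ κ : ℕ) : ℤ))) ∧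
          -- (T-L1) Selmer away from `λ` and the places over `m` (McCallum Lemma 4.3)
          (∀ ℓ m : ℕ, Kol ℓ → KolSupp Kol (ℓ * m) → ¬ ℓ ∣ m →
            ∀ v₀ : HeightOneSpectrum (𝓞 K), (ℓ : 𝓞 K) ∈ v₀.asIdeal →
            ∀ v : Place K, v ≠ Sum.inr v₀ →
              (∀ q : HeightOneSpectrum (𝓞 K), (∃ r ∈ m.primeFactors, (r : 𝓞 K) ∈ q.asIdeal) →
                v ≠ Sum.inr q) →
              cA (ℓ * m) ∈ selmerLocalKer ((cubeSumCurve (3 * (p : ℚ) ^ 2)).baseChange K) (Place.Completion v) ((2 ^ κ * 2 ^ κ : ℕ) : ℤ)) ∧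
          (∀ ℓ m : ℕ, Kol ℓ → KolSupp Kol (ℓ * m) → ¬ ℓ ∣ m →
            ∀ v₀ : HeightOneSpectrum (𝓞 K), (ℓ : 𝓞 K) ∈ v₀.asIdeal →
            ∀ v : Place K, v ≠ Sum.inr v₀ →
              (∀ q : HeightOneSpectrum (𝓞 K), (∃ r ∈ m.primeFactors, (r : 𝓞 K) ∈ q.asIdeal) →
                v ≠ Sum.inr q) →
              cB (ℓ * m) ∈ selmerLocalKer ((cubeSumCurve (p : ℚ)).baseChange K) (Place.Completion v) ((2 ^ κ * 2 ^ κ : ℕ) : ℤ)) ∧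
          -- the Kolyvagin primes' level: `X[4^κ] ⊆ X(K_q)`
          (∀ r : ℕ, Kol r → ∀ q : HeightOneSpectrum (𝓞 K), (r : 𝓞 K) ∈ q.asIdeal →
            ∀ (g : absoluteGaloisGroup (Place.Completion (Sum.inr q : Place K)))
              (Q : geomTorsion ((cubeSumCurve (3 * (p : ℚ) ^ 2)).baseChange K) ((2 ^ κ * 2 ^ κ : ℕ) : ℤ)),
              absGaloisRestrict K (Place.Completion (Sum.inr q : Place K)) g • Q = Q) ∧
          (∀ r : ℕ, Kol r → ∀ q : HeightOneSpectrum (𝓞 K), (r : 𝓞 K) ∈ q.asIdeal →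
            ∀ (g : absoluteGaloisGroup (Place.Completion (Sum.inr q : Place K)))
              (Q : geomTorsion ((cubeSumCurve (p : ℚ)).baseChange K) ((2 ^ κ * 2 ^ κ : ℕ) : ℤ)),
              absGaloisRestrict K (Place.Completion (Sum.inr q : Place K)) g • Q = Q) ∧
          -- (T-L2)′ LOCAL LEAVES, 𝒪-LINE form: NOT BOTH local terms (over `t`, over `w_X t`) vanish
          (∀ ℓ m : ℕ, Kol ℓ → KolSupp Kol (ℓ * m) → ¬ ℓ ∣ m → Even m.primeFactors.card →
            ∀ (j N' a b : ℕ) (t : galH1Torsion ((cubeSumCurve (3 * (p : ℚ) ^ 2)).baseChange K) ((2 ^ κ * 2 ^ κ : ℕ) : ℤ))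
              (ht : t ∈ selmerGroup ((cubeSumCurve (3 * (p : ℚ) ^ 2)).baseChange K) ((2 ^ κ * 2 ^ κ : ℕ) : ℤ))
              (hz : ((2 : ℤ) ^ j) • cA (ℓ * m) ∈ selmerGroup ((cubeSumCurve (3 * (p : ℚ) ^ 2)).baseChange K) ((2 ^ κ * 2 ^ κ : ℕ) : ℤ)),
              ((2 : ℤ) ^ N') • t = 0 →
              (∀ q ∈ m.primeFactors, ∀ v : HeightOneSpectrum (𝓞 K), (q : 𝓞 K) ∈ v.asIdeal →
                t ∈ ((cubeSumCurve (3 * (p : ℚ) ^ 2)).baseChange K).torsionLocalKer (v.adicCompletion K) ((2 ^ κ * 2 ^ κ : ℕ) : ℤ)) →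
              κ ≤ j → N' ≤ κ → N' ≤ j → a + b + 1 = N' →
              (∀ v : HeightOneSpectrum (𝓞 K), (ℓ : 𝓞 K) ∈ v.asIdeal →
                ((2 : ℤ) ^ (a + (j - N'))) • cB m ∉
                  ((cubeSumCurve (p : ℚ)).baseChange K).torsionLocalKer (v.adicCompletion K) ((2 ^ κ * 2 ^ κ : ℕ) : ℤ)) →
              (∀ v : HeightOneSpectrum (𝓞 K), (ℓ : 𝓞 K) ∈ v.asIdeal → ((2 : ℤ) ^ b) • t ∉
                ((cubeSumCurve (3 * (p : ℚ) ^ 2)).baseChange K).torsionLocalKer (v.adicCompletion K) ((2 ^ κ * 2 ^ κ : ℕ) : ℤ)) →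
              ∀ v₀ : HeightOneSpectrum (𝓞 K), (ℓ : 𝓞 K) ∈ v₀.asIdeal →
              (∀ D : FirstCaseData ((cubeSumCurve (3 * (p : ℚ) ^ 2)).baseChange K) (2 ^ κ), D.b₁ = ((2 : ℤ) ^ (j - κ)) • cA (ℓ * m) →
                galoisCohomology.map (inclKD ((cubeSumCurve (3 * (p : ℚ) ^ 2)).baseChange K) (2 ^ κ) (2 ^ κ)) 1 D.b' = t →
                D.localTerm eA hμA hadd₁A hadd₂A hgalA
                  (LocalInvariants.canonical K (2 ^ κ * 2 ^ κ)) (Sum.inr v₀) = 0) →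
              (∀ D : FirstCaseData ((cubeSumCurve (3 * (p : ℚ) ^ 2)).baseChange K) (2 ^ κ), D.b₁ = ((2 : ℤ) ^ (j - κ)) • cA (ℓ * m) →
                galoisCohomology.map (inclKD ((cubeSumCurve (3 * (p : ℚ) ^ 2)).baseChange K) (2 ^ κ) (2 ^ κ)) 1 D.b' =
                  resH1Hom (ContinuousMonoidHom.id _) fnA hfnA t →
                D.localTerm eA hμA hadd₁A hadd₂A hgalA
                  (LocalInvariants.canonical K (2 ^ κ * 2 ^ κ)) (Sum.inr v₀) = 0) →
              False) ∧
          (∀ ℓ m : ℕ, Kol ℓ → KolSupp Kol (ℓ * m) → ¬ ℓ ∣ m → Odd m.primeFactors.card →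
            ∀ (j N' a b : ℕ) (t : galH1Torsion ((cubeSumCurve (p : ℚ)).baseChange K) ((2 ^ κ * 2 ^ κ : ℕ) : ℤ))
              (ht : t ∈ selmerGroup ((cubeSumCurve (p : ℚ)).baseChange K) ((2 ^ κ * 2 ^ κ : ℕ) : ℤ))
              (hz : ((2 : ℤ) ^ j) • cB (ℓ * m) ∈ selmerGroup ((cubeSumCurve (p : ℚ)).baseChange K) ((2 ^ κ * 2 ^ κ : ℕ) : ℤ)),
              ((2 : ℤ) ^ N') • t = 0 →
              (∀ q ∈ m.primeFactors, ∀ v : HeightOneSpectrum (𝓞 K), (q : 𝓞 K) ∈ v.asIdeal →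
                t ∈ ((cubeSumCurve (p : ℚ)).baseChange K).torsionLocalKer (v.adicCompletion K) ((2 ^ κ * 2 ^ κ : ℕ) : ℤ)) →
              κ ≤ j → N' ≤ κ → N' ≤ j → a + b + 1 = N' →
              (∀ v : HeightOneSpectrum (𝓞 K), (ℓ : 𝓞 K) ∈ v.asIdeal →
                ((2 : ℤ) ^ (a + (j - N'))) • cA m ∉
                  ((cubeSumCurve (3 * (p : ℚ) ^ 2)).baseChange K).torsionLocalKer (v.adicCompletion K) ((2 ^ κ * 2 ^ κ : ℕ) : ℤ)) →
              (∀ v : HeightOneSpectrum (𝓞 K), (ℓ : 𝓞 K) ∈ v.asIdeal → ((2 : ℤ) ^ b) • t ∉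
                ((cubeSumCurve (p : ℚ)).baseChange K).torsionLocalKer (v.adicCompletion K) ((2 ^ κ * 2 ^ κ : ℕ) : ℤ)) →
              ∀ v₀ : HeightOneSpectrum (𝓞 K), (ℓ : 𝓞 K) ∈ v₀.asIdeal →
              (∀ D : FirstCaseData ((cubeSumCurve (p : ℚ)).baseChange K) (2 ^ κ), D.b₁ = ((2 : ℤ) ^ (j - κ)) • cB (ℓ * m) →
                galoisCohomology.map (inclKD ((cubeSumCurve (p : ℚ)).baseChange K) (2 ^ κ) (2 ^ κ)) 1 D.b' = t →
                D.localTerm eB hμB hadd₁B hadd₂B hgalB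
                  (LocalInvariants.canonical K (2 ^ κ * 2 ^ κ)) (Sum.inr v₀) = 0) →
              (∀ D : FirstCaseData ((cubeSumCurve (p : ℚ)).baseChange K) (2 ^ κ), D.b₁ = ((2 : ℤ) ^ (j - κ)) • cB (ℓ * m) →
                galoisCohomology.map (inclKD ((cubeSumCurve (p : ℚ)).baseChange K) (2 ^ κ) (2 ^ κ)) 1 D.b' =
                  resH1Hom (ContinuousMonoidHom.id _) fnB hfnB t →
                D.localTerm eB hμB hadd₁B hadd₂B hgalB
                  (LocalInvariants.canonical K (2 ^ κ * 2 ^ κ)) (Sum.inr v₀) = 0) →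
              False) ∧
          -- (T-L3) the MIXED Čebotarev clause (memo Cor. 3.2″) for `w_X := resH1Hom id fn_X hfn_X`
          (∀ (TA : Finset (galH1Torsion ((cubeSumCurve (3 * (p : ℚ) ^ 2)).baseChange K) ((2 ^ κ * 2 ^ κ : ℕ) : ℤ)))
            (TB : Finset (galH1Torsion ((cubeSumCurve (p : ℚ)).baseChange K) ((2 ^ κ * 2 ^ κ : ℕ) : ℤ)))
            (gA : galH1Torsion ((cubeSumCurve (3 * (p : ℚ) ^ 2)).baseChange K) ((2 ^ κ * 2 ^ κ : ℕ) : ℤ))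
            (gB : galH1Torsion ((cubeSumCurve (p : ℚ)).baseChange K) ((2 ^ κ * 2 ^ κ : ℕ) : ℤ)),
            gA ∈ AdmA → gB ∈ AdmB → (↑TA : Set _) ⊆ AdmA → (↑TB : Set _) ⊆ AdmB → ∀ b : ℕ,
            ∃ ℓ, b < ℓ ∧ Kol ℓ ∧
            (∀ g ∈ AddSubgroup.closure (insert gA (insert (resH1Hom (ContinuousMonoidHom.id _) fnA hfnA gA)
                ((TA : Set _) ∪ resH1Hom (ContinuousMonoidHom.id _) fnA hfnA '' (TA : Set _)))),
              (∀ v : HeightOneSpectrum (𝓞 K), (ℓ : 𝓞 K) ∈ v.asIdeal →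
                g ∈ ((cubeSumCurve (3 * (p : ℚ) ^ 2)).baseChange K).torsionLocalKer (v.adicCompletion K)
                  ((2 ^ κ * 2 ^ κ : ℕ) : ℤ)) ↔
              g ∈ AddSubgroup.closure ((TA : Set _) ∪ resH1Hom (ContinuousMonoidHom.id _) fnA hfnA '' (TA : Set _))) ∧
            (∀ g ∈ AddSubgroup.closure (insert gB (insert (resH1Hom (ContinuousMonoidHom.id _) fnB hfnB gB)
                ((TB : Set _) ∪ resH1Hom (ContinuousMonoidHom.id _) fnB hfnB '' (TB : Set _)))),
              (∀ v : HeightOneSpectrum (𝓞 K), (ℓ : 𝓞 K) ∈ v.asIdeal →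
                g ∈ ((cubeSumCurve (p : ℚ)).baseChange K).torsionLocalKer (v.adicCompletion K)
                  ((2 ^ κ * 2 ^ κ : ℕ) : ℤ)) ↔
              g ∈ AddSubgroup.closure ((TB : Set _) ∪ resH1Hom (ContinuousMonoidHom.id _) fnB hfnB '' (TB : Set _)))) ∧
          -- the `ℚ`-KUMMER inputs of the lifts (#K11's five, `T := 2κ`) for `A` and for `B`
          yA ∈ selmerGroup (cubeSumCurve (3 * (p : ℚ) ^ 2)) ((2 ^ κ * 2 ^ κ : ℕ) : ℤ) ∧ torsionH1ToH1 (cubeSumCurve (3 * (p : ℚ) ^ 2)) ((2 ^ κ * 2 ^ κ : ℕ) : ℤ) yA = 0 ∧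
          (∀ a : ℤ, a • yA = 0 → ((2 : ℤ) ^ (2 * κ) ∣ a) ∨ yA = 0) ∧
          (∀ u ∈ selmerGroup (cubeSumCurve (3 * (p : ℚ) ^ 2)) ((2 ^ κ * 2 ^ κ : ℕ) : ℤ), torsionH1ToH1 (cubeSumCurve (3 * (p : ℚ) ^ 2)) ((2 ^ κ * 2 ^ κ : ℕ) : ℤ) u = 0 → ∃ a : ℤ, u = a • yA) ∧
          yB ∈ selmerGroup (cubeSumCurve (p : ℚ)) ((2 ^ κ * 2 ^ κ : ℕ) : ℤ) ∧ torsionH1ToH1 (cubeSumCurve (p : ℚ)) ((2 ^ κ * 2 ^ κ : ℕ) : ℤ) yB = 0 ∧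
          (∀ a : ℤ, a • yB = 0 → ((2 : ℤ) ^ (2 * κ) ∣ a) ∨ yB = 0) ∧
          (∀ u ∈ selmerGroup (cubeSumCurve (p : ℚ)) ((2 ^ κ * 2 ^ κ : ℕ) : ℤ), torsionH1ToH1 (cubeSumCurve (p : ℚ)) ((2 ^ κ * 2 ^ κ : ℕ) : ℤ) u = 0 → ∃ a : ℤ, u = a • yB)
    := by
  intro hF p hp h9 h3 A B _ _ _ _ hB hA hguard qB qA hqB hqA hne K _ _ ω hω h2 CB hCB P Y hPinf hPgen hht
  obtain ⟨M₀, x₀, T, hT, hY, hval, hx₀⟩ := provenance_halved_sylvesterPair hC hF p hp h9 h3 A B hB hA hguard qB qA hqB hqA hne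
    K ω hω h2 CB hCB P Y hPinf hPgen hht
  refine ⟨M₀, x₀, T, hT, hY, hval, ?_⟩
  intro κ _ hκ φA fnA hfnA hφA hcoeA φB fnB hfnB hφB hcoeB eA hμA hadd₁A hadd₂A hgalA haltA hnondegA
    eB hμB hadd₁B hadd₂B hgalB haltB hnondegB
  -- ### scalars, instances, the CM involution `c` of `K`
  have hp3 : p % 3 = 1 := by omega
  have hp0 : p ≠ 0 := hp.ne_zero
  have hp0' : (p : ℚ) ≠ 0 := by exact_mod_cast hp0
  have hp2 : p ≠ 2 := by rintro rfl; norm_num at h9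
  have hp3ne : p ≠ 3 := by rintro rfl; norm_num at h9
  have hpodd : Odd (p : ℤ) := by exact_mod_cast hp.odd_of_ne_two hp2
  have hK := JZero.isImaginaryQuadratic_of_sq_add_self_add_one hω h2
  have hdK := JZero.discr_eq_neg_three_of_sq_add_self_add_one hω h2
  have hm0 : 9 * p ≠ 0 := mul_ne_zero (by norm_num) hp0
  haveI := Rank1Residual.X12.CubeSumFamilies.isElliptic_cubeSumCurve hp0'
  haveI := Rank1Residual.X12.CubeSumFamilies.isElliptic_cubeSumCurve
    (mul_ne_zero (by norm_num) (pow_ne_zero 2 hp0') : (3 * (p : ℚ) ^ 2) ≠ 0)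
  haveI := isElliptic_cubeSumCurve_baseChange K hp0'
  haveI := isElliptic_cubeSumCurve_baseChange K (mul_ne_zero (by norm_num) (pow_ne_zero 2 hp0') : (3 * (p : ℚ) ^ 2) ≠ 0)
  haveI : Algebra.IsAlgebraic ℚ K := Algebra.IsAlgebraic.of_finite ℚ K
  obtain ⟨-, -, c, hcω, -⟩ := JZero.exists_aut_apply_eq_sq K hω h2
  -- ### the global choices: coherent embeddings, fixers, CM points, coherent generators, frames, transversal
  let ι : K →+* ℂ := (IsAlgClosed.lift : K →ₐ[ℚ] ℂ).toRingHom
  obtain ⟨emb, hemb, hcoh⟩ := exists_coherent_emb (K := K) ι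
  obtain ⟨Nf, hNf⟩ := exists_levelFixers ι emb hemb
  obtain ⟨y, hy⟩ := exists_sylvesterPoints hK hdK ι Dt hp3
  obtain ⟨σ, hσgal, hσcompat, hσgen⟩ := exists_coherentGenerators hK ι hp0 emb hemb hcoh
  obtain ⟨κ₉, hκG, hκf⟩ := exists_frameTransport_pinned K
  obtain ⟨vB, vA, ψB, ψA, ρ, hvBc, hvB, -, hvAc, hvA0, hvB3, hvA3, hψB, hψA, hρ, hρρ, hlawB, hlawA, hρcomm⟩ :=
    exists_coupledFrame (K := K) hω hp0
  haveI := (finiteDimensional_and_isGalois_ringClassField hK ι hm0).1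
  haveI := (finiteDimensional_and_isGalois_ringClassField hK ι hm0).2
  obtain ⟨r₃, hr₃⟩ := IsAlgClosed.exists_pow_nat_eq (3 : ℂ) (by norm_num : 0 < 3)
  obtain ⟨rp, hrp⟩ := IsAlgClosed.exists_pow_nat_eq (p : ℂ) (by norm_num : 0 < 3)
  have hrp_mem : rp ∈ ringClassField K ι (9 * p) := by
    have h := cubeRoot_mem_ringClassField_nine_mul hω h2 ι hp0 one_ne_zero rp hrp
    rwa [mul_one] at h
  let c₃ : ringClassField K ι (9 * p) := ⟨r₃, cubeRoot_three_mem_ringClassField hω h2 ι hp0 r₃ hr₃⟩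
  let cp : ringClassField K ι (9 * p) := ⟨rp, hrp_mem⟩
  have hc₃ : c₃ ^ 3 = 3 := by apply Subtype.ext; push_cast; exact hr₃
  have hcp : cp ^ 3 = (p : ringClassField K ι (9 * p)) := by apply Subtype.ext; push_cast; exact hrp
  obtain ⟨N₀, hN₀, H, hH, Tl, hTl, -, hfin, hbij⟩ := exists_bottom_transversal hK ι hp0 (emb (9 * p)) (hemb _) c₃ cp
  haveI := hfin
  haveI : Fintype ((ringClassField K ι (9 * p) ≃ₐ[K] ringClassField K ι (9 * p)) ⧸ H) := Fintype.ofFinite _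
  haveI : Fintype H := Fintype.ofFinite _
  let t : ((ringClassField K ι (9 * p) ≃ₐ[K] ringClassField K ι (9 * p)) ⧸ H) × H → absoluteGaloisGroup K :=
    fun i ↦ Tl (Quotient.out i.1) * Tl (i.2 : _)
  have ht' : ∀ q h, t (q, h) = Tl (Quotient.out q) * Tl (h : _) := fun _ _ ↦ rfl
  have ht := hbij t ht'
  obtain ⟨y₁, hy₁⟩ := exists_map_eq_phi_sylvesterTau_one_of_sq_add_self_add_one hω h2 ι Dt hp3
  -- ### THE HALVED CHOICES from (W2-b): the bottom involution `s ∈ H`, a half `H′`, the half fixer `N″`, the `φ n`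
  obtain ⟨sH, H', N'', φl, hs1, hs2, hsy, hH', hN''₀, hdich, hlift, hN''vB, hN''vA, ht'', hφs, hφy, hφ2, hφτ⟩ :=
    exists_halvedChoices_sylvesterTower Dt hW2b hp h9 hω h2 ι emb hemb hvBc hvAc N₀ hN₀ hc₃ hcp H hH Tl hTl t ht' y₁ hy₁ y hy
  have hs2' : (sH : ringClassField K ι (9 * p) ≃ₐ[K] ringClassField K ι (9 * p)) *
      (sH : ringClassField K ι (9 * p) ≃ₐ[K] ringClassField K ι (9 * p)) = 1 := by
    rw [← Subgroup.coe_mul, hs2, Subgroup.coe_one]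
  have hs3 : (sH : ringClassField K ι (9 * p) ≃ₐ[K] ringClassField K ι (9 * p)) c₃ = c₃ := ((hH _).mp sH.2).1
  have hsp : (sH : ringClassField K ι (9 * p) ≃ₐ[K] ringClassField K ι (9 * p)) cp = cp := ((hH _).mp sH.2).2
  let ιe : (n : ℕ) → (letI : DecidableEq (ringClassField K ι (9 * p * n)) := fun a b ↦ Classical.propDecidable (a = b)
      ((⟨0, 0, 1, 0, -1⟩ : WeierstrassCurve ℚ).baseChange (ringClassField K ι (9 * p * n))).toAffine.Point →+
        geomPoints ((⟨0, 0, 1, 0, -1⟩ : WeierstrassCurve ℚ).baseChange K)) := fun n ↦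
    letI : DecidableEq (ringClassField K ι (9 * p * n)) := fun a b ↦ Classical.propDecidable (a = b)
    Affine.Point.map (W' := (⟨0, 0, 1, 0, -1⟩ : WeierstrassCurve ℚ)) (emb (9 * p * n)).toRatAlgHom
  have hιe : ∀ n Q, ιe n Q =
      Affine.Point.map (W' := (⟨0, 0, 1, 0, -1⟩ : WeierstrassCurve ℚ)) (emb (9 * p * n)).toRatAlgHom Q := fun _ _ ↦ rfl
  let ιe₀ : (letI : DecidableEq (ringClassField K ι (9 * p)) := fun a b ↦ Classical.propDecidable (a = b)
      ((⟨0, 0, 1, 0, -1⟩ : WeierstrassCurve ℚ).baseChange (ringClassField K ι (9 * p))).toAffine.Point →+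
        geomPoints ((⟨0, 0, 1, 0, -1⟩ : WeierstrassCurve ℚ).baseChange K)) :=
    letI : DecidableEq (ringClassField K ι (9 * p)) := fun a b ↦ Classical.propDecidable (a = b)
    Affine.Point.map (W' := (⟨0, 0, 1, 0, -1⟩ : WeierstrassCurve ℚ)) (emb (9 * p)).toRatAlgHom
  have hιe₀ : ∀ Q, ιe₀ Q =
      Affine.Point.map (W' := (⟨0, 0, 1, 0, -1⟩ : WeierstrassCurve ℚ)) (emb (9 * p)).toRatAlgHom Q := fun _ ↦ rfl
  -- ### the Kolyvagin-prime predicate's moduli `N_A = 3p·N(A)`, `N_B = N(B)`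
  haveI : NeZero (3 * p * (cubeSumCurve (3 * (p : ℚ) ^ 2)).conductorNorm ℤ) :=
    ⟨mul_ne_zero (mul_ne_zero three_ne_zero hp0) (conductorNorm_pos_holds _).ne'⟩
  haveI : NeZero ((cubeSumCurve (p : ℚ)).conductorNorm ℤ) := ⟨(conductorNorm_pos_holds _).ne'⟩
  -- ### the HALVED class system (l.74, l.79c, l.100–120) and its FLIPs (l.87–98)
  obtain ⟨Pt, cA, cB, hPt, hLD, hcA, hcB, hcB1, h74, hSelA, hSelB, hLevA, hLevB⟩ :=
    exists_classSystemHalved_sylvesterPair hω h2 ι Dt hp h9 κ hκ (NA := 3 * p * (cubeSumCurve (3 * (p : ℚ) ^ 2)).conductorNorm ℤ)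
      (NB := (cubeSumCurve (p : ℚ)).conductorNorm ℤ) (dvd_mul_right _ _) (dvd_mul_left _ _) dvd_rfl 0 _
      (fun ℓ ↦ Iff.rfl) M₀ x₀ emb hemb hcoh ιe hιe Nf hNf y hy σ hσgen κ₉ hκG hvBc hvB hvAc hvA0 hvB3 hvA3 hψB hψA hρ
      hρρ hlawB hlawA N₀ hN₀ (sH : ringClassField K ι (9 * p) ≃ₐ[K] ringClassField K ι (9 * p)) hs1 hs2' hc₃ hcp hs3 hsp
      N'' hN''₀ hdich hN''vB hN''vA
      (fun i : ((ringClassField K ι (9 * p) ≃ₐ[K] ringClassField K ι (9 * p)) ⧸ H) × H' ↦ t (i.1, (i.2 : H))) ht'' φl hφs hφy hφ2 hφτ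
  obtain ⟨hflipE, hflipO⟩ := classSystemHalved_flip_sylvesterPair hω h2 ι Dt hp h9 κ hκ
      (NA := 3 * p * (cubeSumCurve (3 * (p : ℚ) ^ 2)).conductorNorm ℤ) (NB := (cubeSumCurve (p : ℚ)).conductorNorm ℤ)
      (dvd_mul_left _ _) dvd_rfl 0 _ (fun ℓ ↦ Iff.rfl) M₀ x₀ emb hemb hcoh ιe hιe Nf hNf y hy σ hσgen κ₉ hκG hvBc hvB
      hvAc hvA0 hvB3 hvA3 hψB hψA hρ hρρ hlawB hlawA N₀ hN₀ hES2 hσgal hσcompat hρcomm hκf hF hD hdeg hC h3 A B hA qB qA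
      hqB hqA hne CB hCB P Y hPinf hPgen hht hT hY y₁ hy₁ ιe₀ hιe₀ hc₃ hcp H hH Tl hTl t ht' ht sH hs2 H' hH' hsy N'' hN''₀
      hdich hN''vB hN''vA ht'' φB fnB hfnB hφB hcoeB Pt hPt hLD cA cB hcA hcB hcB1
  -- ### admissibility of the halved classes (H-J: l.81, l.82 for `n ≠ 1`)
  obtain ⟨h81, h82⟩ := kolyvaginClassesHalved_mem_admLines_sylvesterPair hω h2 ι Dt hp h9 κ hκ
      (NA := 3 * p * (cubeSumCurve (3 * (p : ℚ) ^ 2)).conductorNorm ℤ) (NB := (cubeSumCurve (p : ℚ)).conductorNorm ℤ)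
      (dvd_mul_right _ _) (dvd_mul_left _ _) dvd_rfl 0 _ (fun ℓ ↦ Iff.rfl) emb hemb hcoh ιe hιe Nf hNf y hy σ hσgen
      hσgal κ₉ hκG hκf hvBc hvB hvAc hvA0 hvB3 hvA3 hψB hψA hρ hρρ hlawB hlawA N₀ hN₀
      (sH : ringClassField K ι (9 * p) ≃ₐ[K] ringClassField K ι (9 * p)) hs2' N'' hN''₀ hdich hlift hN''vB hN''vA
      (fun i : ((ringClassField K ι (9 * p) ≃ₐ[K] ringClassField K ι (9 * p)) ⧸ H) × H' ↦ t (i.1, (i.2 : H))) ht'' φl hφs hφy φA fnA hfnA hφA hcoeA φB fnB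
      hfnB hφB hcoeB hcω Pt hPt hLD cA cB hcA hcB
  -- ### the ℚ-Kummer five: `A(ℚ)` is finite (HSY Thm. 1.4), `B(ℚ) = ⟨P⟩ + torsion`
  obtain ⟨-, -, -, hA0, -⟩ := hF.1.1 p hp (Or.inr h9) h3 A B hB hA
  haveI : Finite A.toAffine.Point := finite_point_of_rank_zero (W := A) hA0
  obtain ⟨CA, hCA⟩ := hA
  obtain ⟨a1, a2, a3, a4⟩ := kummerFive_of_torsion_transport κ (cubeSumCurve (3 * (p : ℚ) ^ 2)) A rfl
    (fun x ↦ (cube_add_ne_zero_sylvester hp hp2 hp3ne x).2) CA hCA (fun Q ↦ isOfFinAddOrder_of_finite Q)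
  obtain ⟨b1, b2, b3, b4⟩ := kummerFive_of_generator_transport K κ (cubeSumCurve (p : ℚ)) B rfl
    (fun x ↦ (cube_add_ne_zero_sylvester hp hp2 hp3ne x).1) CB hCB P hPinf hPgen
  -- ### THE RESIDUE
  refine ⟨_, _, _, _, cA, cB, 0, _, h74, rfl, two_pow_pred_zsmul_kummerMapTorsion_ne_zero _ κ hκ _ x₀ hx₀, hcB1,
    fun n hn _ ↦ h81 n hn, fun n hn _ ↦ ?_, zero_mem_admLines _ c _ _, zero_mem_admLines _ c _ _,
    fun u _ ↦ resTorsion_mem_admLines hω h2 hcω _ _ _ u, fun u _ ↦ resTorsion_mem_admLines hω h2 hcω _ _ _ u,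
    hflipE, hflipO, hSelA, hSelB, hLevA, hLevB, ?_, ?_,
    cebotarev_kernelForm_sylvesterPair_lines hω h2 hp hp3 hcω κ hκ φA fnA hfnA hφA hcoeA φB fnB hfnB hφB hcoeB 0,
    a1, a2, a3, a4, b1, b2, b3, b4⟩
  · -- l.82: `c′_B(1) = 2^{M₀} • δ x₀` (H-I), `c′_B(n)`, `n ≠ 1` (H-J)
    by_cases hn1 : n = 1
    · subst hn1
      rw [hcB1]
      exact zsmul_kummerMapTorsion_mem_admLines hF hp (Or.inr h9) h3 A B ⟨CA, hCA⟩ hω h2 c CB hCB P hPinf hPgen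
        (2 ^ κ * 2 ^ κ) (M := 2 * κ) (by rw [two_mul, pow_add]) _ φB fnB hfnB hφB hcoeB _ x₀
    · exact h82 n hn hn1
  · -- (T-L2)′ for `A_K` over `B_K` (`m` even)
    intro ℓ m hℓ hℓm _ hpar j N' a b tt htt hz htN _ hκj hN'κ _ habN hxB hbt v₀ hv₀ hD1 hD2
    exact tl2Leaf_cubeSumCurve_of_flip hω h2 ⟨3 * (p : ℤ) ^ 2, Odd.mul (by decide) (hpodd.pow), by push_cast; ring⟩ _
      hκ φA fnA hfnA hφA hcoeA eA hμA hadd₁A hadd₂A hgalA haltA hnondegA hℓ.1 hℓ.2.2.2.2.1 (hLevA ℓ hℓ) (cA (ℓ * m))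
      (cB m) (hflipE ℓ m hℓ hℓm hpar) j N' a b tt htt hz htN hκj hN'κ habN hxB hbt v₀ hv₀ hD1 hD2
  · -- (T-L2)′ for `B_K` over `A_K` (`m` odd)
    intro ℓ m hℓ hℓm _ hpar j N' a b tt htt hz htN _ hκj hN'κ _ habN hxB hbt v₀ hv₀ hD1 hD2
    exact tl2Leaf_cubeSumCurve_of_flip hω h2 ⟨(p : ℤ), hpodd, by push_cast; ring⟩ _
      hκ φB fnB hfnB hφB hcoeB eB hμB hadd₁B hadd₂B hgalB haltB hnondegB hℓ.1 hℓ.2.2.2.2.1 (hLevB ℓ hℓ) (cB (ℓ * m))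
      (cA m) (hflipO ℓ m hℓ hℓm hpar) j N' a b tt htt hz htN hκj hN'κ habN hxB hbt v₀ hv₀ hD1 hD2

end Summit.BirchSwinnertonDyer.BirchSwinnertonDyer.Theorems.SylvesterTwoCoupledTelescope

end
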